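import Mathlib
import HarnessLib
import Summits.Langlands.Langlands.Theses.E8QuinticResidue

noncomputable section

open scoped NumberField
open IsDedekindDomain Field Polynomial Filter
open Literature.NumberTheory.GaloisRepresentations Literature.NumberTheory.Automorphic

set_option linter.dupNamespace false

/-!
# Birth skeleton of piece X1 `IcosahedralShadow` (child of NoChimeras, stmt-Langlands-11145) — BC3

Two stubs and a real composition:
* `stub_projectiveA5Lift` (S1a) — from the Booker pair and the quintic field `K`: an irreducible
  icosahedral `σ₀` with `det σ₀(Frob_v) = 1` and `tr σ₀(Frob_v)² ∈ {λ², (λ^τ)²}` a.e. (the projective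
  `A₅`-representation of `Gal(K̃/ℚ)` — Chebotarev on cycle types, `D₅`/`C₅` excluded — lifted to
  `SL₂(ℂ)` — Tate + Serre's obstruction; traces match `λ` up to sign AND up to the `5A/5B` swap);
* `stub_fiveCycleCoherence` (S1b) — the `5A/5B` ambiguity resolves globally: some `σ₁` (σ₀ or its
  Galois conjugate `φ ↔ φ^τ`) has `tr σ₁(Frob_v) = e_v λ_v`, `e_v² = 1`, at a.e. `v`;
* `IcosahedralShadow_of : S1a → S1b → IcosahedralShadow` — Vieta for two-element multisets turns
  `X² - e λ X + 1` into `satakePolynomial (e • α)` (`card α = 2`, `∏ α = 1`, `∑ α = λ`).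
-/

namespace Summit.Langlands.Langlands.Cruxes.IcosahedralShadow.Birth

/-- Stub S1a — projective `A₅`-representation of `Gal(K̃/ℚ)` lifted to `SL₂(ℂ)`, traces matching
`λ` up to sign and up to `5A/5B`. [cite: Booker2018, Thm. 1] [cite: Kim2004, §1] -/
theorem stub_projectiveA5Lift : ∀ (hcpt : Literature.NumberTheory.Automorphic.isCompact_glFiniteIntegralLevel 2 ℚ) (π π' : Literature.NumberTheory.Automorphic.CuspidalAutomorphicRepData 2 ℚ hcpt), ¬ π.1.IsNearlyEquivalent π'.1 → (∀ (K : Type) [Field K] [NumberField K], Module.finrank ℚ K = 2 → ¬ ∀ᶠ v : IsDedekindDomain.HeightOneSpectrum (NumberField.RingOfIntegers ℚ) in Filter.cofinite, (Ideal.span {((v.residueCard : ℕ) : NumberField.RingOfIntegers K)}).IsPrime → ∀ α : Multiset ℂ, π.1.HasSatakeParamAt v α → π.1.HasSatakeParamAt v (α.map fun a => -a)) → (∀ (K : Type) [Field K] [NumberField K], Module.finrank ℚ K = 2 → ¬ ∀ᶠ v : IsDedekindDomain.HeightOneSpectrum (NumberField.RingOfIntegers ℚ) in Filter.cofinite, (Ideal.span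 {((v.residueCard : ℕ) : NumberField.RingOfIntegers K)}).IsPrime → ∀ α : Multiset ℂ, π'.1.HasSatakeParamAt v α → π'.1.HasSatakeParamAt v (α.map fun a => -a)) → (∀ᶠ v : IsDedekindDomain.HeightOneSpectrum (NumberField.RingOfIntegers ℚ) in Filter.cofinite, ∃ α α' : Multiset ℂ, π.1.HasSatakeParamAt v α ∧ π'.1.HasSatakeParamAt v α' ∧ α.prod = 1 ∧ α'.prod = 1 ∧ ∃ a b : ℤ, α.sum = (a : ℂ) + (b : ℂ) * ((1 + (Real.sqrt 5 : ℂ)) / 2) ∧ α'.sum = (a : ℂ) + (b : ℂ) * ((1 - (Real.sqrt 5 : ℂ)) / 2) ∧ ((b = 0 ∧ (a = 0 ∨ a = 1 ∨ a = -1 ∨ a = 2 ∨ a = -2)) ∨ (b = 1 ∧ (a = 0 ∨ a = -1)) ∨ (b = -1 ∧ (a = 0 ∨ a = 1)))) → (∀ᶠ v : IsDedekindDomain.HeightOneSpectrum (NumberField.RingOfIntegers ℚ) in Filter.cofinite, (∀ α : Multiset ℂ, π.1.HasSatakeParamAt v α → ∀ a ∈ α, ‖a‖ = 1) ∧ (∀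 α' : Multiset ℂ, π'.1.HasSatakeParamAt v α' → ∀ a ∈ α', ‖a‖ = 1)) → ∀ (K : Type) [Field K] [NumberField K], Module.finrank ℚ K = 5 → (∀ᶠ v : IsDedekindDomain.HeightOneSpectrum (NumberField.RingOfIntegers ℚ) in Filter.cofinite, ∀ (α α' : Multiset ℂ) (a b : ℤ), π.1.HasSatakeParamAt v α → π'.1.HasSatakeParamAt v α' → α.sum = (a : ℂ) + (b : ℂ) * ((1 + (Real.sqrt 5 : ℂ)) / 2) → α'.sum = (a : ℂ) + (b : ℂ) * ((1 - (Real.sqrt 5 : ℂ)) / 2) → ∃ F : Multiset ℕ, (UniqueFactorizationMonoid.normalizedFactors (Ideal.span {((v.residueCard : ℕ) : NumberField.RingOfIntegers K)})).Nodup ∧ (UniqueFactorizationMonoid.normalizedFactors (Ideal.span {((v.residueCard : ℕ) : NumberField.RingOfIntegers K)})).map (fun P => Ideal.absNorm P) = F ∧ (b = 0 → (a = 2 ∨ a = -2) → F = Multiset.replicate 5 v.residueCard) ∧ (b = 0 → a = 0 → F = {v.residueCard ^ 2, v.residueCard ^ 2, v.residueCard}) ∧ (b = 0 → (a = 1 ∨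 a = -1) → F = {v.residueCard ^ 3, v.residueCard, v.residueCard}) ∧ (((a = 0 ∧ (b = 1 ∨ b = -1)) ∨ (a = 1 ∧ b = -1) ∨ (a = -1 ∧ b = 1)) → F = {v.residueCard ^ 5})) → ∃ σ₀ : Literature.NumberTheory.GaloisRepresentations.FramedGaloisRep ℚ ℂ 2, σ₀.toGaloisRep.IsIrreducible ∧ Nonempty ((Matrix.ProjGenLinGroup.mk.comp σ₀.toMonoidHom).range ≃* alternatingGroup (Fin 5)) ∧ ∀ᶠ v : IsDedekindDomain.HeightOneSpectrum (NumberField.RingOfIntegers ℚ) in Filter.cofinite, ∃ (α : Multiset ℂ) (a b : ℤ), π.1.HasSatakeParamAt v α ∧ α.prod = 1 ∧ α.sum = ((a : ℂ) + (b : ℂ) * ((1 + (Real.sqrt 5 : ℂ)) / 2)) ∧ σ₀.IsUnramifiedAt v ∧ ∃ t : ℂ, σ₀.HasFrobCharpolyAt v (Polynomial.X ^ 2 - Polynomial.C t * Polynomial.X + 1) ∧ (t ^ 2 = ((a : ℂ) + (b : ℂ) * ((1 + (Real.sqrt 5 : ℂ)) / 2)) ^ 2 ∨ t ^ 2 = ((a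 : ℂ) + (b : ℂ) * ((1 - (Real.sqrt 5 : ℂ)) / 2)) ^ 2) := by
  sorry

/-- Stub S1b — global coherence of the `5A/5B` choice. [cite: Buhler1978, Ch. 3] -/
theorem stub_fiveCycleCoherence : ∀ (hcpt : Literature.NumberTheory.Automorphic.isCompact_glFiniteIntegralLevel 2 ℚ) (π π' : Literature.NumberTheory.Automorphic.CuspidalAutomorphicRepData 2 ℚ hcpt), ¬ π.1.IsNearlyEquivalent π'.1 → (∀ (K : Type) [Field K] [NumberField K], Module.finrank ℚ K = 2 → ¬ ∀ᶠ v : IsDedekindDomain.HeightOneSpectrum (NumberField.RingOfIntegers ℚ) in Filter.cofinite, (Ideal.span {((v.residueCard : ℕ) : NumberField.RingOfIntegers K)}).IsPrime → ∀ α : Multiset ℂ, π.1.HasSatakeParamAt v α → π.1.HasSatakeParamAt v (α.map fun a => -a)) → (∀ (K : Type) [Field K] [NumberField K], Module.finrank ℚ K = 2 → ¬ ∀ᶠ v : IsDedekindDomain.HeightOneSpectrum (NumberField.RingOfIntegers ℚ) in Filter.cofinite, (Ideal.span {((v.residueCard : ℕ) : NumberField.RingOfIntegers K)}).IsPrime →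 ∀ α : Multiset ℂ, π'.1.HasSatakeParamAt v α → π'.1.HasSatakeParamAt v (α.map fun a => -a)) → (∀ᶠ v : IsDedekindDomain.HeightOneSpectrum (NumberField.RingOfIntegers ℚ) in Filter.cofinite, ∃ α α' : Multiset ℂ, π.1.HasSatakeParamAt v α ∧ π'.1.HasSatakeParamAt v α' ∧ α.prod = 1 ∧ α'.prod = 1 ∧ ∃ a b : ℤ, α.sum = (a : ℂ) + (b : ℂ) * ((1 + (Real.sqrt 5 : ℂ)) / 2) ∧ α'.sum = (a : ℂ) + (b : ℂ) * ((1 - (Real.sqrt 5 : ℂ)) / 2) ∧ ((b = 0 ∧ (a = 0 ∨ a = 1 ∨ a = -1 ∨ a = 2 ∨ a = -2)) ∨ (b = 1 ∧ (a = 0 ∨ a = -1)) ∨ (b = -1 ∧ (a = 0 ∨ a = 1)))) → (∀ᶠ v : IsDedekindDomain.HeightOneSpectrum (NumberField.RingOfIntegers ℚ) in Filter.cofinite, (∀ α : Multiset ℂ, π.1.HasSatakeParamAt v α → ∀ a ∈ α, ‖a‖ = 1) ∧ (∀ α' : Multiset ℂ, π'.1.HasSatakeParamAt v α' → ∀ a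 ∈ α', ‖a‖ = 1)) → ∀ σ₀ : Literature.NumberTheory.GaloisRepresentations.FramedGaloisRep ℚ ℂ 2, σ₀.toGaloisRep.IsIrreducible → Nonempty ((Matrix.ProjGenLinGroup.mk.comp σ₀.toMonoidHom).range ≃* alternatingGroup (Fin 5)) → (∀ᶠ v : IsDedekindDomain.HeightOneSpectrum (NumberField.RingOfIntegers ℚ) in Filter.cofinite, ∃ (α : Multiset ℂ) (a b : ℤ), π.1.HasSatakeParamAt v α ∧ α.prod = 1 ∧ α.sum = ((a : ℂ) + (b : ℂ) * ((1 + (Real.sqrt 5 : ℂ)) / 2)) ∧ σ₀.IsUnramifiedAt v ∧ ∃ t : ℂ, σ₀.HasFrobCharpolyAt v (Polynomial.X ^ 2 - Polynomial.C t * Polynomial.X + 1) ∧ (t ^ 2 = ((a : ℂ) + (b : ℂ) * ((1 + (Real.sqrt 5 : ℂ)) / 2)) ^ 2 ∨ t ^ 2 = ((a : ℂ) + (b : ℂ) * ((1 - (Real.sqrt 5 : ℂ)) / 2)) ^ 2)) → ∃ σ₁ : Literature.NumberTheory.GaloisRepresentations.FramedGaloisRep ℚ ℂ 2, σ₁.toGaloisRep.IsIrreducible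 ∧ Nonempty ((Matrix.ProjGenLinGroup.mk.comp σ₁.toMonoidHom).range ≃* alternatingGroup (Fin 5)) ∧ ∀ᶠ v : IsDedekindDomain.HeightOneSpectrum (NumberField.RingOfIntegers ℚ) in Filter.cofinite, ∃ (α : Multiset ℂ) (a b : ℤ), π.1.HasSatakeParamAt v α ∧ α.prod = 1 ∧ α.sum = ((a : ℂ) + (b : ℂ) * ((1 + (Real.sqrt 5 : ℂ)) / 2)) ∧ σ₁.IsUnramifiedAt v ∧ ∃ e : ℂ, e ^ 2 = 1 ∧ σ₁.HasFrobCharpolyAt v (Polynomial.X ^ 2 - Polynomial.C (e * ((a : ℂ) + (b : ℂ) * ((1 + (Real.sqrt 5 : ℂ)) / 2))) * Polynomial.X + 1) := by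
  sorry

/-- Vieta for a two-element multiset: `satakePolynomial {x, y} = X² - (x + y) X + x y`. [folklore] -/
theorem satakePolynomial_pair (x y : ℂ) :
    satakePolynomial ({x, y} : Multiset ℂ) = X ^ 2 - C (x + y) * X + C (x * y) := by
  simp only [satakePolynomial, Multiset.insert_eq_cons, Multiset.map_cons, Multiset.map_singleton,
    Multiset.prod_cons, Multiset.prod_singleton, map_add, map_mul]
  ring

/-- `satakePolynomial (e • α) = X² - e λ X + 1` for `card α = 2`, `∏ α = 1`, `∑ α = λ`, `e² = 1`.
[folklore] -/
theorem satakePolynomial_smul_eq {α : Multiset ℂ} (hc : Multiset.card α = 2) (hp : α.prod = 1)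
    {l e : ℂ} (hs : α.sum = l) (he : e ^ 2 = 1) :
    satakePolynomial (α.map fun a => e * a) = X ^ 2 - C (e * l) * X + 1 := by
  obtain ⟨x, y, rfl⟩ := Multiset.card_eq_two.mp hc
  simp only [Multiset.insert_eq_cons, Multiset.prod_cons, Multiset.prod_singleton, Multiset.sum_cons,
    Multiset.sum_singleton] at hp hs
  have hmap : (({x, y} : Multiset ℂ).map fun a => e * a) = {e * x, e * y} := by
    simp [Multiset.insert_eq_cons]
  rw [hmap, satakePolynomial_pair]
  have h1 : e * x * (e * y) = 1 := by
    calc e * x * (e * y) = e ^ 2 * (x * y) := by ring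
      _ = 1 := by rw [he, hp, one_mul]
  rw [h1, ← hs, mul_add, map_one]

/-- **X1 from S1a and S1b.** -/
theorem IcosahedralShadow_of : (∀ (hcpt : Literature.NumberTheory.Automorphic.isCompact_glFiniteIntegralLevel 2 ℚ) (π π' : Literature.NumberTheory.Automorphic.CuspidalAutomorphicRepData 2 ℚ hcpt), ¬ π.1.IsNearlyEquivalent π'.1 → (∀ (K : Type) [Field K] [NumberField K], Module.finrank ℚ K = 2 → ¬ ∀ᶠ v : IsDedekindDomain.HeightOneSpectrum (NumberField.RingOfIntegers ℚ) in Filter.cofinite, (Ideal.span {((v.residueCard : ℕ) : NumberField.RingOfIntegers K)}).IsPrime → ∀ α : Multiset ℂ, π.1.HasSatakeParamAt v α → π.1.HasSatakeParamAt v (α.map fun a => -a)) → (∀ (K : Type) [Field K] [NumberField K], Module.finrank ℚ K = 2 → ¬ ∀ᶠ v : IsDedekindDomain.HeightOneSpectrum (NumberField.RingOfIntegers ℚ) in Filter.cofinite, (Ideal.span {((v.residueCard : ℕ) : NumberField.RingOfIntegers K)}).IsPrime → ∀ α : Multiset ℂ, π'.1.HasSatakeParamAt v α → π'.1.HasSatakeParamAt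 v (α.map fun a => -a)) → (∀ᶠ v : IsDedekindDomain.HeightOneSpectrum (NumberField.RingOfIntegers ℚ) in Filter.cofinite, ∃ α α' : Multiset ℂ, π.1.HasSatakeParamAt v α ∧ π'.1.HasSatakeParamAt v α' ∧ α.prod = 1 ∧ α'.prod = 1 ∧ ∃ a b : ℤ, α.sum = (a : ℂ) + (b : ℂ) * ((1 + (Real.sqrt 5 : ℂ)) / 2) ∧ α'.sum = (a : ℂ) + (b : ℂ) * ((1 - (Real.sqrt 5 : ℂ)) / 2) ∧ ((b = 0 ∧ (a = 0 ∨ a = 1 ∨ a = -1 ∨ a = 2 ∨ a = -2)) ∨ (b = 1 ∧ (a = 0 ∨ a = -1)) ∨ (b = -1 ∧ (a = 0 ∨ a = 1)))) → (∀ᶠ v : IsDedekindDomain.HeightOneSpectrum (NumberField.RingOfIntegers ℚ) in Filter.cofinite, (∀ α : Multiset ℂ, π.1.HasSatakeParamAt v α → ∀ a ∈ α, ‖a‖ = 1) ∧ (∀ α' : Multiset ℂ, π'.1.HasSatakeParamAt v α' → ∀ a ∈ α', ‖a‖ = 1)) → ∀ (K : Type) [Field K] [NumberField K], Module.finrank ℚ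 K = 5 → (∀ᶠ v : IsDedekindDomain.HeightOneSpectrum (NumberField.RingOfIntegers ℚ) in Filter.cofinite, ∀ (α α' : Multiset ℂ) (a b : ℤ), π.1.HasSatakeParamAt v α → π'.1.HasSatakeParamAt v α' → α.sum = (a : ℂ) + (b : ℂ) * ((1 + (Real.sqrt 5 : ℂ)) / 2) → α'.sum = (a : ℂ) + (b : ℂ) * ((1 - (Real.sqrt 5 : ℂ)) / 2) → ∃ F : Multiset ℕ, (UniqueFactorizationMonoid.normalizedFactors (Ideal.span {((v.residueCard : ℕ) : NumberField.RingOfIntegers K)})).Nodup ∧ (UniqueFactorizationMonoid.normalizedFactors (Ideal.span {((v.residueCard : ℕ) : NumberField.RingOfIntegers K)})).map (fun P => Ideal.absNorm P) = F ∧ (b = 0 → (a = 2 ∨ a = -2) → F = Multiset.replicate 5 v.residueCard) ∧ (b = 0 → a = 0 → F = {v.residueCard ^ 2, v.residueCard ^ 2, v.residueCard}) ∧ (b = 0 → (a = 1 ∨ a = -1) → F = {v.residueCard ^ 3, v.residueCard, v.residueCard}) ∧ (((a = 0 ∧ (b = 1 ∨ b = -1)) ∨ (a = 1 ∧ b = -1)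 ∨ (a = -1 ∧ b = 1)) → F = {v.residueCard ^ 5})) → ∃ σ₀ : Literature.NumberTheory.GaloisRepresentations.FramedGaloisRep ℚ ℂ 2, σ₀.toGaloisRep.IsIrreducible ∧ Nonempty ((Matrix.ProjGenLinGroup.mk.comp σ₀.toMonoidHom).range ≃* alternatingGroup (Fin 5)) ∧ ∀ᶠ v : IsDedekindDomain.HeightOneSpectrum (NumberField.RingOfIntegers ℚ) in Filter.cofinite, ∃ (α : Multiset ℂ) (a b : ℤ), π.1.HasSatakeParamAt v α ∧ α.prod = 1 ∧ α.sum = ((a : ℂ) + (b : ℂ) * ((1 + (Real.sqrt 5 : ℂ)) / 2)) ∧ σ₀.IsUnramifiedAt v ∧ ∃ t : ℂ, σ₀.HasFrobCharpolyAt v (Polynomial.X ^ 2 - Polynomial.C t * Polynomial.X + 1) ∧ (t ^ 2 = ((a : ℂ) + (b : ℂ) * ((1 + (Real.sqrt 5 : ℂ)) / 2)) ^ 2 ∨ t ^ 2 = ((a : ℂ) + (b : ℂ) * ((1 - (Real.sqrt 5 : ℂ)) / 2)) ^ 2)) → (∀ (hcpt : Literature.NumberTheory.Automorphic.isCompact_glFiniteIntegralLevel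 2 ℚ) (π π' : Literature.NumberTheory.Automorphic.CuspidalAutomorphicRepData 2 ℚ hcpt), ¬ π.1.IsNearlyEquivalent π'.1 → (∀ (K : Type) [Field K] [NumberField K], Module.finrank ℚ K = 2 → ¬ ∀ᶠ v : IsDedekindDomain.HeightOneSpectrum (NumberField.RingOfIntegers ℚ) in Filter.cofinite, (Ideal.span {((v.residueCard : ℕ) : NumberField.RingOfIntegers K)}).IsPrime → ∀ α : Multiset ℂ, π.1.HasSatakeParamAt v α → π.1.HasSatakeParamAt v (α.map fun a => -a)) → (∀ (K : Type) [Field K] [NumberField K], Module.finrank ℚ K = 2 → ¬ ∀ᶠ v : IsDedekindDomain.HeightOneSpectrum (NumberField.RingOfIntegers ℚ) in Filter.cofinite, (Ideal.span {((v.residueCard : ℕ) : NumberField.RingOfIntegers K)}).IsPrime → ∀ α : Multiset ℂ, π'.1.HasSatakeParamAt v α → π'.1.HasSatakeParamAt v (α.map fun a => -a)) → (∀ᶠ v : IsDedekindDomain.HeightOneSpectrum (NumberField.RingOfIntegers ℚ) in Filter.cofinite, ∃ α α' : Multiset ℂ, π.1.HasSatakeParamAt v α ∧ π'.1.HasSatakeParamAt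 v α' ∧ α.prod = 1 ∧ α'.prod = 1 ∧ ∃ a b : ℤ, α.sum = (a : ℂ) + (b : ℂ) * ((1 + (Real.sqrt 5 : ℂ)) / 2) ∧ α'.sum = (a : ℂ) + (b : ℂ) * ((1 - (Real.sqrt 5 : ℂ)) / 2) ∧ ((b = 0 ∧ (a = 0 ∨ a = 1 ∨ a = -1 ∨ a = 2 ∨ a = -2)) ∨ (b = 1 ∧ (a = 0 ∨ a = -1)) ∨ (b = -1 ∧ (a = 0 ∨ a = 1)))) → (∀ᶠ v : IsDedekindDomain.HeightOneSpectrum (NumberField.RingOfIntegers ℚ) in Filter.cofinite, (∀ α : Multiset ℂ, π.1.HasSatakeParamAt v α → ∀ a ∈ α, ‖a‖ = 1) ∧ (∀ α' : Multiset ℂ, π'.1.HasSatakeParamAt v α' → ∀ a ∈ α', ‖a‖ = 1)) → ∀ σ₀ : Literature.NumberTheory.GaloisRepresentations.FramedGaloisRep ℚ ℂ 2, σ₀.toGaloisRep.IsIrreducible → Nonempty ((Matrix.ProjGenLinGroup.mk.comp σ₀.toMonoidHom).range ≃* alternatingGroup (Fin 5)) → (∀ᶠ v : IsDedekindDomain.HeightOneSpectrum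 (NumberField.RingOfIntegers ℚ) in Filter.cofinite, ∃ (α : Multiset ℂ) (a b : ℤ), π.1.HasSatakeParamAt v α ∧ α.prod = 1 ∧ α.sum = ((a : ℂ) + (b : ℂ) * ((1 + (Real.sqrt 5 : ℂ)) / 2)) ∧ σ₀.IsUnramifiedAt v ∧ ∃ t : ℂ, σ₀.HasFrobCharpolyAt v (Polynomial.X ^ 2 - Polynomial.C t * Polynomial.X + 1) ∧ (t ^ 2 = ((a : ℂ) + (b : ℂ) * ((1 + (Real.sqrt 5 : ℂ)) / 2)) ^ 2 ∨ t ^ 2 = ((a : ℂ) + (b : ℂ) * ((1 - (Real.sqrt 5 : ℂ)) / 2)) ^ 2)) → ∃ σ₁ : Literature.NumberTheory.GaloisRepresentations.FramedGaloisRep ℚ ℂ 2, σ₁.toGaloisRep.IsIrreducible ∧ Nonempty ((Matrix.ProjGenLinGroup.mk.comp σ₁.toMonoidHom).range ≃* alternatingGroup (Fin 5)) ∧ ∀ᶠ v : IsDedekindDomain.HeightOneSpectrum (NumberField.RingOfIntegers ℚ) in Filter.cofinite, ∃ (α : Multiset ℂ) (a b : ℤ), π.1.HasSatakeParamAt v α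 ∧ α.prod = 1 ∧ α.sum = ((a : ℂ) + (b : ℂ) * ((1 + (Real.sqrt 5 : ℂ)) / 2)) ∧ σ₁.IsUnramifiedAt v ∧ ∃ e : ℂ, e ^ 2 = 1 ∧ σ₁.HasFrobCharpolyAt v (Polynomial.X ^ 2 - Polynomial.C (e * ((a : ℂ) + (b : ℂ) * ((1 + (Real.sqrt 5 : ℂ)) / 2))) * Polynomial.X + 1)) → (∀ (hcpt : Literature.NumberTheory.Automorphic.isCompact_glFiniteIntegralLevel 2 ℚ) (π π' : Literature.NumberTheory.Automorphic.CuspidalAutomorphicRepData 2 ℚ hcpt), ¬ π.1.IsNearlyEquivalent π'.1 → (∀ (K : Type) [Field K] [NumberField K], Module.finrank ℚ K = 2 → ¬ ∀ᶠ v : IsDedekindDomain.HeightOneSpectrum (NumberField.RingOfIntegers ℚ) in Filter.cofinite, (Ideal.span {((v.residueCard : ℕ) : NumberField.RingOfIntegers K)}).IsPrime → ∀ α : Multiset ℂ, π.1.HasSatakeParamAt v α → π.1.HasSatakeParamAt v (α.map fun a => -a)) → (∀ (K : Type) [Field K] [NumberField K], Module.finrank ℚ K = 2 → ¬ ∀ᶠ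 v : IsDedekindDomain.HeightOneSpectrum (NumberField.RingOfIntegers ℚ) in Filter.cofinite, (Ideal.span {((v.residueCard : ℕ) : NumberField.RingOfIntegers K)}).IsPrime → ∀ α : Multiset ℂ, π'.1.HasSatakeParamAt v α → π'.1.HasSatakeParamAt v (α.map fun a => -a)) → (∀ᶠ v : IsDedekindDomain.HeightOneSpectrum (NumberField.RingOfIntegers ℚ) in Filter.cofinite, ∃ α α' : Multiset ℂ, π.1.HasSatakeParamAt v α ∧ π'.1.HasSatakeParamAt v α' ∧ α.prod = 1 ∧ α'.prod = 1 ∧ ∃ a b : ℤ, α.sum = (a : ℂ) + (b : ℂ) * ((1 + (Real.sqrt 5 : ℂ)) / 2) ∧ α'.sum = (a : ℂ) + (b : ℂ) * ((1 - (Real.sqrt 5 : ℂ)) / 2) ∧ ((b = 0 ∧ (a = 0 ∨ a = 1 ∨ a = -1 ∨ a = 2 ∨ a = -2)) ∨ (b = 1 ∧ (a = 0 ∨ a = -1)) ∨ (b = -1 ∧ (a = 0 ∨ a = 1)))) → (∀ᶠ v : IsDedekindDomain.HeightOneSpectrum (NumberField.RingOfIntegers ℚ) in Filter.cofinite, (∀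 α : Multiset ℂ, π.1.HasSatakeParamAt v α → ∀ a ∈ α, ‖a‖ = 1) ∧ (∀ α' : Multiset ℂ, π'.1.HasSatakeParamAt v α' → ∀ a ∈ α', ‖a‖ = 1)) → ∀ (K : Type) [Field K] [NumberField K], Module.finrank ℚ K = 5 → (∀ᶠ v : IsDedekindDomain.HeightOneSpectrum (NumberField.RingOfIntegers ℚ) in Filter.cofinite, ∀ (α α' : Multiset ℂ) (a b : ℤ), π.1.HasSatakeParamAt v α → π'.1.HasSatakeParamAt v α' → α.sum = (a : ℂ) + (b : ℂ) * ((1 + (Real.sqrt 5 : ℂ)) / 2) → α'.sum = (a : ℂ) + (b : ℂ) * ((1 - (Real.sqrt 5 : ℂ)) / 2) → ∃ F : Multiset ℕ, (UniqueFactorizationMonoid.normalizedFactors (Ideal.span {((v.residueCard : ℕ) : NumberField.RingOfIntegers K)})).Nodup ∧ (UniqueFactorizationMonoid.normalizedFactors (Ideal.span {((v.residueCard : ℕ) : NumberField.RingOfIntegers K)})).map (fun P => Ideal.absNorm P) = F ∧ (b = 0 → (a = 2 ∨ a = -2) → F = Multiset.replicate 5 v.residueCard) ∧ (b = 0 → a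 = 0 → F = {v.residueCard ^ 2, v.residueCard ^ 2, v.residueCard}) ∧ (b = 0 → (a = 1 ∨ a = -1) → F = {v.residueCard ^ 3, v.residueCard, v.residueCard}) ∧ (((a = 0 ∧ (b = 1 ∨ b = -1)) ∨ (a = 1 ∧ b = -1) ∨ (a = -1 ∧ b = 1)) → F = {v.residueCard ^ 5})) → ∃ σ₀ : Literature.NumberTheory.GaloisRepresentations.FramedGaloisRep ℚ ℂ 2, σ₀.toGaloisRep.IsIrreducible ∧ Nonempty ((Matrix.ProjGenLinGroup.mk.comp σ₀.toMonoidHom).range ≃* alternatingGroup (Fin 5)) ∧ ∀ᶠ v : IsDedekindDomain.HeightOneSpectrum (NumberField.RingOfIntegers ℚ) in Filter.cofinite, ∃ α : Multiset ℂ, π.1.HasSatakeParamAt v α ∧ σ₀.IsUnramifiedAt v ∧ ∃ e : ℂ, e ^ 2 = 1 ∧ σ₀.HasFrobCharpolyAt v (Literature.NumberTheory.Automorphic.satakePolynomial (α.map fun a => e * a))) := by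
  intro hA hB hcpt π π' hne hnd hnd' hAl hT K _ _ hK hP
  obtain ⟨σ₀, hirr, hico, hM⟩ := hA hcpt π π' hne hnd hnd' hAl hT K hK hP
  obtain ⟨σ₁, hirr₁, hico₁, hM₁⟩ := hB hcpt π π' hne hnd hnd' hAl hT σ₀ hirr hico hM
  refine ⟨σ₁, hirr₁, hico₁, ?_⟩
  filter_upwards [hM₁] with v hv
  obtain ⟨α, a, b, hα, hprod, hsum, hur, e, he, hcp⟩ := hv
  refine ⟨α, hα, hur, e, he, ?_⟩
  rw [satakePolynomial_smul_eq hα.card_eq hprod hsum he]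
  exact hcp

end Summit.Langlands.Langlands.Cruxes.IcosahedralShadow.Birth

end
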